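import Summits.KontsevichZagierPeriods.KontsevichZagierPeriods.Theorems.LinRedNormalFormArrangementNormalFormSeparateThreeHHKForms
import Summits.KontsevichZagierPeriods.KontsevichZagierPeriods.Theorems.LinRedNormalFormArrangementNormalFormSeparateThreeHIPoly

/-!
# The numerator at a base point: real Taylor data in the graded form

(Line `janus-bands`, crux `ArrangementNormalForm`, stub `stub_separateHigh`, part `HHKTaylor` of
the wall-invariant termwise-split lemma `separateThree_hHk` in base dimension `3` with fibres.)
The numerator of a terminal piece over the base `ℝ³` is `F(x) = ∑_{i<N} qᵢ(x′) λ(x)^i`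
(`x′ = (x₀, x₁)`, `λ(x) = x₂ − (l₁ x₀ + l₂ x₁ + l₀)`, `qᵢ` real polynomials in two variables);
the Taylor pieces are its terms. At a base point `z₁` the real Taylor data of the `qᵢ` at `z₁′`
(`SepThree.exists_coef_data`) bring `F(z₁ + ξ)` to the graded form `SepHHK.Fnum` of part
`HHKForms`:
* at a point OF THE POLE PLANE (`λ(z₁) = 0`): `F(z₁ + ξ) = Fnum l₁ l₂ c ξ` and the `i`-th
  Taylor piece is `Fpc l₁ l₂ c i ξ` (`exists_data_pole`, registered as `separateThreeHHK_taylor`);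
* at ANY point: re-expanding in powers of the centred pole coordinate (binomial theorem), again
  `F(z₁ + ξ) = Fnum l₁ l₂ ĉ ξ` for some data `ĉ` (`exists_data_any`) — away from the pole plane
  only the numerator as a whole matters (the pieces are bounded there).
-/

noncomputable section

open Set MvPolynomial

namespace Summit.KontsevichZagierPeriods.ArrangementNormalForm.JanusBands

namespace SepHHK

open SepTwo

/-- The pole coordinate `λ(x) = x₂ − (l₁ x₀ + l₂ x₁ + l₀)`. -/
def lam3 (l₁ l₂ l₀ : ℝ) (x : Fin 3 → ℝ) : ℝ := x 2 - (l₁ * x 0 + l₂ * x 1 + l₀)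

/-- The first two coordinates of a base point. -/
def pr2 (x : Fin 3 → ℝ) : Fin 2 → ℝ := fun i => x (Fin.castSucc i)

/-- The pole coordinate is affine with linear part `lamL`. -/
theorem lam3_add (l₁ l₂ l₀ : ℝ) (z₁ ξ : Fin 3 → ℝ) :
    lam3 l₁ l₂ l₀ (z₁ + ξ) = lam3 l₁ l₂ l₀ z₁ + lamL l₁ l₂ ξ := by
  simp only [lam3, lamL, Pi.add_apply]; ring

/-- Projection of a sum. -/
theorem pr2_add (z₁ ξ : Fin 3 → ℝ) : pr2 (z₁ + ξ) = pr2 z₁ + pr2 ξ := rfl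

/-- Coordinates of the projection. -/
theorem pr2_apply0 (ξ : Fin 3 → ℝ) : pr2 ξ 0 = ξ 0 := rfl

/-- Coordinates of the projection. -/
theorem pr2_apply1 (ξ : Fin 3 → ℝ) : pr2 ξ 1 = ξ 1 := rfl

/-- A piece in graded form: `λ(ξ)^i · pev₂ (c i) ξ₀ ξ₁ = Fpc l₁ l₂ c i ξ`. -/
theorem Fpc_eq_mul_pev₂ {D : ℕ} (l₁ l₂ : ℝ) (c : Coef₃ D) (i : Fin (D + 1)) (ξ : Fin 3 → ℝ) :
    Fpc l₁ l₂ c i ξ = pev₂ (c i) (ξ 0) (ξ 1) * lamL l₁ l₂ ξ ^ (i : ℕ) := by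
  unfold Fpc nterm pev₂
  rw [Finset.sum_mul]
  refine Finset.sum_congr rfl fun m₁ _ => ?_
  rw [Finset.sum_mul]
  refine Finset.sum_congr rfl fun m₂ _ => ?_
  ring

/-- **Real Taylor data at a point of the pole plane.** See the module docstring. -/
theorem exists_data_pole (N : ℕ) (q : ℕ → MvPolynomial (Fin 2) ℝ) (l₁ l₂ l₀ : ℝ) (z₁ : Fin 3 → ℝ)
    (hlam : lam3 l₁ l₂ l₀ z₁ = 0) :
    ∃ (D : ℕ) (hND : N ≤ D + 1) (c : Coef₃ D),
      (∀ ξ : Fin 3 → ℝ, (∑ i ∈ Finset.range N, eval (pr2 (z₁ + ξ)) (q i) * lam3 l₁ l₂ l₀ (z₁ + ξ) ^ i) =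
        Fnum l₁ l₂ c ξ) ∧
      (∀ (i : ℕ) (hi : i < N) (ξ : Fin 3 → ℝ), eval (pr2 (z₁ + ξ)) (q i) * lam3 l₁ l₂ l₀ (z₁ + ξ) ^ i =
        Fpc l₁ l₂ c ⟨i, lt_of_lt_of_le hi hND⟩ ξ) ∧
      (∀ i : Fin (D + 1), N ≤ (i : ℕ) → c i = 0) := by
  obtain ⟨D, hND, c, hc, hc0⟩ := SepThree.exists_coef_data N q (pr2 z₁)
  have hpiece : ∀ (i : ℕ) (hi : i < N) (ξ : Fin 3 → ℝ),
      eval (pr2 (z₁ + ξ)) (q i) * lam3 l₁ l₂ l₀ (z₁ + ξ) ^ i = Fpc l₁ l₂ c ⟨i, lt_of_lt_of_le hi hND⟩ ξ := by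
    intro i hi ξ
    rw [pr2_add, hc i hi, lam3_add, hlam, zero_add, Fpc_eq_mul_pev₂]
    rfl
  refine ⟨D, hND, c, fun ξ => ?_, hpiece, hc0⟩
  unfold Fnum
  rw [SepThree.sum_range_eq_sum_fin _ hND]
  refine Finset.sum_congr rfl fun i _ => ?_
  by_cases hi : (i : ℕ) < N
  · rw [if_pos hi, hpiece i hi ξ]
  · rw [if_neg hi]
    unfold Fpc nterm
    simp [hc0 i (not_lt.1 hi)]

/-- The binomial re-expansion of the Taylor data about the pole value `pv`. -/
def cshift {D : ℕ} (pv : ℝ) (c : Coef₃ D) : Coef₃ D :=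
  fun j m₁ m₂ => ∑ i : Fin (D + 1), ((i : ℕ).choose j : ℝ) * pv ^ ((i : ℕ) - j) * c i m₁ m₂

/-- The binomial theorem over `Fin (D + 1)`. -/
theorem add_pow_fin {D : ℕ} (x y : ℝ) (i : Fin (D + 1)) :
    (x + y) ^ (i : ℕ) = ∑ j : Fin (D + 1), ((i : ℕ).choose j : ℝ) * y ^ ((i : ℕ) - j) * x ^ (j : ℕ) := by
  rw [add_pow, Fin.sum_univ_eq_sum_range (fun j => ((i : ℕ).choose j : ℝ) * y ^ ((i : ℕ) - j) * x ^ j)]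
  have hsub : Finset.range ((i : ℕ) + 1) ⊆ Finset.range (D + 1) := fun j hj =>
    Finset.mem_range.2 (lt_of_lt_of_le (Finset.mem_range.1 hj)
      (Nat.succ_le_succ (Nat.lt_succ_iff.1 i.2)))
  rw [← Finset.sum_subset hsub]
  · exact Finset.sum_congr rfl fun j _ => by ring
  · intro j _ hj
    rw [Finset.mem_range, not_lt] at hj
    rw [Nat.choose_eq_zero_of_lt (Nat.lt_of_succ_le hj)]
    simp

/-- **The re-expansion identity**: `∑ᵢ (pv + λ(ξ))^i Qᵢ = Fnum (cshift pv c)`. -/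
theorem Fnum_shift {D : ℕ} (l₁ l₂ pv : ℝ) (c : Coef₃ D) (ξ : Fin 3 → ℝ) :
    (∑ i : Fin (D + 1), pev₂ (c i) (ξ 0) (ξ 1) * (pv + lamL l₁ l₂ ξ) ^ (i : ℕ)) =
      Fnum l₁ l₂ (cshift pv c) ξ := by
  -- expand both sides into quadruple sums over `(i, j, m₁, m₂)`
  have hL : ∀ i : Fin (D + 1), pev₂ (c i) (ξ 0) (ξ 1) * (pv + lamL l₁ l₂ ξ) ^ (i : ℕ) =
      ∑ j : Fin (D + 1), ∑ m₁ : Fin (D + 1), ∑ m₂ : Fin (D + 1),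
        ((i : ℕ).choose j : ℝ) * pv ^ ((i : ℕ) - j) * c i m₁ m₂ *
          lamL l₁ l₂ ξ ^ (j : ℕ) * ξ 0 ^ (m₁ : ℕ) * ξ 1 ^ (m₂ : ℕ) := by
    intro i
    rw [add_comm pv, add_pow_fin, Finset.mul_sum]
    refine Finset.sum_congr rfl fun j _ => ?_
    unfold pev₂
    rw [Finset.sum_mul]
    refine Finset.sum_congr rfl fun m₁ _ => ?_
    rw [Finset.sum_mul]
    refine Finset.sum_congr rfl fun m₂ _ => ?_
    ring
  simp_rw [hL]
  rw [Finset.sum_comm]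
  unfold Fnum Fpc nterm cshift
  refine Finset.sum_congr rfl fun j _ => ?_
  rw [Finset.sum_comm]
  refine Finset.sum_congr rfl fun m₁ _ => ?_
  rw [Finset.sum_comm]
  refine Finset.sum_congr rfl fun m₂ _ => ?_
  rw [Finset.sum_mul, Finset.sum_mul, Finset.sum_mul]

/-- **Real Taylor data at any base point, in graded form.** See the module docstring. -/
theorem exists_data_any (N : ℕ) (q : ℕ → MvPolynomial (Fin 2) ℝ) (l₁ l₂ l₀ : ℝ) (z₁ : Fin 3 → ℝ) :
    ∃ (D : ℕ) (c : Coef₃ D), ∀ ξ : Fin 3 → ℝ,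
      (∑ i ∈ Finset.range N, eval (pr2 (z₁ + ξ)) (q i) * lam3 l₁ l₂ l₀ (z₁ + ξ) ^ i) =
        Fnum l₁ l₂ c ξ := by
  obtain ⟨D, hND, c, hc, hc0⟩ := SepThree.exists_coef_data N q (pr2 z₁)
  refine ⟨D, cshift (lam3 l₁ l₂ l₀ z₁) c, fun ξ => ?_⟩
  rw [← Fnum_shift, SepThree.sum_range_eq_sum_fin _ hND]
  refine Finset.sum_congr rfl fun i _ => ?_
  by_cases hi : (i : ℕ) < N
  · rw [if_pos hi, pr2_add, hc i hi, lam3_add]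
    rfl
  · rw [if_neg hi, hc0 i (not_lt.1 hi)]
    simp [pev₂]

/-- Bounds for a continuous function of `(v, u) ∈ [0, 1]²` through the direction map. -/
theorem exists_bound_unit_square (f : (Fin 3 → ℝ) → ℝ) (hf : Continuous f) (d Q S : Fin 3 → ℝ) :
    ∃ B : ℝ, 0 ≤ B ∧ ∀ v ∈ Icc (0 : ℝ) 1, ∀ u ∈ Icc (0 : ℝ) 1, |f (evec d Q S v u)| ≤ B := by
  have hc : Continuous fun p : ℝ × ℝ => f (evec d Q S p.1 p.2) := hf.comp (continuous_evec d Q S)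
  have hK : IsCompact (Icc (0 : ℝ) 1 ×ˢ Icc (0 : ℝ) 1) := isCompact_Icc.prod isCompact_Icc
  obtain ⟨B, hB⟩ := hK.exists_bound_of_continuousOn hc.continuousOn
  refine ⟨max B 0, le_max_right _ _, fun v hv u hu => ?_⟩
  have h := hB (v, u) ⟨hv, hu⟩
  rw [Real.norm_eq_abs] at h
  exact h.trans (le_max_left _ _)

end SepHHK

/-- **Real Taylor data of the numerator at a point of the pole plane, in graded form**
(registered part of `stub_separateHigh`, base dimension `3` with fibres; literal consequence of
`SepHHK.exists_data_pole`): at a base point `z₁` with `λ(z₁) = 0`, the numerator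
`∑_{i<N} qᵢ(x′) λ(x)^i` at `x = z₁ + ξ` is the graded polynomial `SepHHK.Fnum l₁ l₂ c ξ` of the
real Taylor data `c` of the `qᵢ` at `z₁′`. -/
theorem separateThreeHHK_taylor (N : ℕ) (q : ℕ → MvPolynomial (Fin 2) ℝ) (l₁ l₂ l₀ : ℝ) (z₁ : Fin 3 → ℝ) (hlam : z₁ 2 - (l₁ * z₁ 0 + l₂ * z₁ 1 + l₀) = 0) : ∃ (D : ℕ) (c : Fin (D + 1) → Fin (D + 1) → Fin (D + 1) → ℝ), ∀ ξ : Fin 3 → ℝ, (∑ i ∈ Finset.range N, MvPolynomial.eval (fun j : Fin 2 => (z₁ + ξ) (Fin.castSucc j)) (q i) * ((z₁ + ξ) 2 - (l₁ * (z₁ + ξ) 0 + l₂ * (z₁ + ξ) 1 + l₀)) ^ i) = SepHHK.Fnum l₁ l₂ c ξ := by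
  obtain ⟨D, -, c, hc, -⟩ := SepHHK.exists_data_pole N q l₁ l₂ l₀ z₁ hlam
  exact ⟨D, c, hc⟩

end Summit.KontsevichZagierPeriods.ArrangementNormalForm.JanusBands
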